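import Literature.Computability.MetaComplexity.EFModMulURD
import HarnessLib

/-!
# The mask law of uniform modular multiplication: `a ⊗ (c ∧ b) = c ∧ (a ⊗ b)`

Layer E/7 (uniform variant). For two available multipliers `V = a ⊗ w` and `V' = a ⊗ b` with
the same multiplicand and modulus, where the multiplier of `V` is the mask `wⱼ ↔ c ∧ bⱼ` of
that of `V'` (lines), every partial product of `V` is the mask of that of `V'`:
`P_t(V)ᵢ ↔ c ∧ P_t(V')ᵢ` (`ModMulU.MaskMul.isBlock_lines`). Carry systems relate the
two modular adders of a stage (sum bits, difference bits, and — using `a < n`, i.e. `n > 0` —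
the comparison bits; two systems `MS1`, `MS2`), then the outputs and the masks follow by local rules.

## Sources

* S. A. Cook, R. A. Reckhow, *The relative efficiency of propositional proof systems*,
  J. Symbolic Logic 44 (1979), §2.
-/

namespace Literature.Computability.MetaComplexity

open _root_.Computability Complexity Complexity.PropForm Netlist Cluster FregeSystem

namespace ModMulU

namespace MaskMul

/-! ### The system and the rules -/

/-- **System `MS1`**: the adders of `x ⊕ y` and `x' ⊕ y'` with `x = c ∧ x'`, `y = c ∧ y'` (premise shapes as definitions): the sum bits satisfy `s ↔ c ∧ s'` (per-position rule).
Leaves: 1 ka, 2 kb, 3 c, 4 x2, 5 y2; defined: 6 x, 7 y, 8 s, 9 kan, 10 s2, 11 kbn. Invariant: the reachable carry states (3 terms). [folklore] -/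
def MS1 : System where
  cins := [biimp (var 1) (const false), biimp (var 2) (const false)]
  shapes := [biimp (var 6) (conj (var 3) (var 4)),
    biimp (var 7) (conj (var 3) (var 5)),
    biimp (var 8) (xor3F (var 6) (var 7) (var 1)),
    biimp (var 9) (majF (var 6) (var 7) (var 1)),
    biimp (var 10) (xor3F (var 4) (var 5) (var 2)),
    biimp (var 11) (majF (var 4) (var 5) (var 2))]
  inv := (disj (conj (neg (var 1)) (neg (var 2))) (disj (conj (neg (var 1)) (neg (var 3))) (conj (var 1) (conj (var 2) (var 3)))))
  next := fun k => if k = 1 then 9 else if k = 2 then 11 else k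

/-- Per-position rule of `MS1`: `s ↔ c ∧ s'`. [cite: CookReckhow1979, §2 (sound rule)] -/
def rMS1Pos : FregeRule := MS1.endRule MS1.shapes (biimp (var 8) (conj (var 3) (var 10)))

/-- **System `MS2`**: the comparators with `n` of two sum words `s = c ∧ s'` (premise shape as a definition) and `s'`, and the comparator `(a, n)`: the difference bits satisfy `c → (d ↔ d')` (per-position rule), and `a < n` gives `ge ↔ c ∧ ge'` at the end.
Leaves: 1 ga, 2 gb, 3 al, 4 c, 5 s2, 6 n, 7 a; defined: 8 s, 9 ny, 10 gan, 11 ny2, 12 gbn, 13 nA, 14 aln, 15 d, 16 d2. Invariant: the reachable carry states (4 terms). [folklore] -/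
def MS2 : System where
  cins := [biimp (var 1) (const true), biimp (var 2) (const true), biimp (var 3) (const true)]
  shapes := [biimp (var 8) (conj (var 4) (var 5)),
    biimp (var 9) (neg (var 6)),
    biimp (var 10) (majF (var 8) (var 9) (var 1)),
    biimp (var 11) (neg (var 6)),
    biimp (var 12) (majF (var 5) (var 11) (var 2)),
    biimp (var 13) (neg (var 6)),
    biimp (var 14) (majF (var 7) (var 13) (var 3)),
    biimp (var 15) (xor3F (var 8) (var 9) (var 1)),
    biimp (var 16) (xor3F (var 5) (var 11) (var 2))]
  inv := (disj (disj (conj (neg (var 1)) (neg (var 2))) (conj (neg (var 1)) (neg (var 4)))) (disj (conj (var 1) (conj (var 2) (var 4))) (conj (var 2) (conj (var 3) (neg (var 4))))))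
  next := fun k => if k = 1 then 10 else if k = 2 then 12 else if k = 3 then 14 else k

/-- Per-position rule of `MS2`: `c → (d ↔ d')`. [cite: CookReckhow1979, §2 (sound rule)] -/
def rMS2Pos : FregeRule := MS2.endRule MS2.shapes (disj (neg (var 4)) (biimp (var 15) (var 16)))

/-- End rule of `MS2`: `¬α` gives `γ ↔ c ∧ γ'`. [cite: CookReckhow1979, §2 (sound rule)] -/
def rMS2End : FregeRule := MS2.endRule [neg (var 3)] (biimp (var 1) (conj (var 4) (var 2)))

/-- `R ↔ mux(g, d, s)`, `R' ↔ mux(g', d', s')`, `g ↔ c ∧ g'`, `s ↔ c ∧ s'`, `¬c ∨ (d ↔ d')` give `R ↔ c ∧ R'`.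
[cite: CookReckhow1979, §2 (sound rule)] -/
def rMuxRel : FregeRule :=
  ⟨[ctx (var 0) (biimp (var 1) (muxF (var 2) (var 3) (var 4))), ctx (var 0) (biimp (var 5) (muxF (var 6) (var 7) (var 8))),
    ctx (var 0) (biimp (var 2) (conj (var 9) (var 6))), ctx (var 0) (biimp (var 4) (conj (var 9) (var 8))),
    ctx (var 0) (disj (neg (var 9)) (biimp (var 3) (var 7)))], ctx (var 0) (biimp (var 1) (conj (var 9) (var 5)))⟩
/-- `m ↔ w ∧ a`, `m' ↔ b ∧ a`, `w ↔ c ∧ b` give `m ↔ c ∧ m'`. [cite: CookReckhow1979, §2 (sound rule)] -/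
def rMaskRel : FregeRule :=
  ⟨[ctx (var 0) (biimp (var 1) (conj (var 2) (var 3))), ctx (var 0) (biimp (var 4) (conj (var 5) (var 3))),
    ctx (var 0) (biimp (var 2) (conj (var 6) (var 5)))], ctx (var 0) (biimp (var 1) (conj (var 6) (var 4)))⟩
/-- `¬p`, `¬q` give `p ↔ c ∧ q`. [cite: CookReckhow1979, §2 (sound rule)] -/
def rRelFF : FregeRule := ⟨[ctx (var 0) (neg (var 1)), ctx (var 0) (neg (var 3))], ctx (var 0) (biimp (var 1) (conj (var 2) (var 3)))⟩

/-- The rules of the mask law. [cite: CookReckhow1979, §2] -/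
def rules : List FregeRule := [MS1.baseRule, MS1.stepRule, rMS1Pos, MS2.baseRule, MS2.stepRule, rMS2Pos, rMS2End, rMuxRel, rMaskRel, rRelFF]

/-- Every rule is sound. [cite: CookReckhow1979, §2 (sound rule)] -/
theorem isSound_of_mem_rules : ∀ r ∈ rules, r.IsSound := by
  intro r hr
  simp only [rules, List.mem_cons, List.not_mem_nil, or_false] at hr
  rcases hr with rfl | rfl | rfl | rfl | rfl | rfl | rfl | rfl | rfl | rfl
  · exact FregeRule.isSound_of_check (by decide +kernel)
  · exact FregeRule.isSound_of_checkD (V := 6) (ds := MS1.ds) (by decide +kernel)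
  · exact FregeRule.isSound_of_checkD (V := 6) (ds := MS1.ds) (by decide +kernel)
  · exact FregeRule.isSound_of_check (by decide +kernel)
  · exact FregeRule.isSound_of_checkD (V := 8) (ds := MS2.ds) (by decide +kernel)
  · exact FregeRule.isSound_of_checkD (V := 8) (ds := MS2.ds) (by decide +kernel)
  · exact FregeRule.isSound_of_check (by decide +kernel)
  · exact FregeRule.isSound_of_check (by decide +kernel)
  · exact FregeRule.isSound_of_check (by decide +kernel)
  · exact FregeRule.isSound_of_check (by decide +kernel)

/-- Leaf side conditions. [folklore] -/
theorem ms1LeavesOK : MS1.LeavesOK := System.leavesOK_of_leavesOKB (by decide +kernel)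
/-- Leaf side conditions. [folklore] -/
theorem ms2LeavesOK : MS2.LeavesOK := System.leavesOK_of_leavesOKB (by decide +kernel)

/-- Inference by rule number `i`. [folklore] -/
theorem infer {G : FregeSystem} (hG : ∀ r ∈ rules, r ∈ G.rules) (i : ℕ) (hi : i < rules.length) {S : Set (PropForm ℕ)}
    (σ : ℕ → PropForm ℕ) {φ : PropForm ℕ} (hφ : (rules[i]).conclusion.subst σ = φ)
    (hp : ∀ ψ ∈ (rules[i]).premises, ψ.subst σ ∈ S) : G.IsInferredFrom S φ :=
  hφ ▸ FregeSystem.IsInferredFrom.of_rule (hG _ (List.getElem_mem hi)) σ rfl hp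

/-! ### Two related modular adders -/

/-- The data of two related modular adders: `M = x ⊕ y`, `M' = x' ⊕ y'` on the same modulus,
with `x = c ∧ x'`, `y = c ∧ y'` bitwise (lines), and a comparator `(a, n)` answering `<`. [folklore] -/
structure RelData where
  /-- width -/
  L : ℕ
  /-- base of `M` -/
  bM : ℕ
  /-- base of `M'` -/
  bM' : ℕ
  /-- operands of `M` -/
  x : ℕ → ℕ
  /-- operands of `M` -/
  y : ℕ → ℕ
  /-- operands of `M'` -/
  x' : ℕ → ℕ
  /-- operands of `M'` -/
  y' : ℕ → ℕ
  /-- the modulus -/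
  nw : ℕ → ℕ
  /-- base of the comparator -/
  bCA : ℕ
  /-- the compared word -/
  a : ℕ → ℕ
  /-- the bit -/
  c : ℕ

namespace RelData

variable (d : RelData)

/-- `M`. [folklore] -/
def M : ModAddU.View := ⟨d.bM, d.x, d.y, d.nw⟩
/-- `M'`. [folklore] -/
def M' : ModAddU.View := ⟨d.bM', d.x', d.y', d.nw⟩
/-- The comparator. [folklore] -/
def CA : Sub.View := ⟨d.bCA, d.a, d.nw⟩

/-- Leaf assignment of `MS1`. [folklore] -/
def act1 (i : ℕ) (k : ℕ) : ℕ :=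
  [0, d.M.S.c i, d.M'.S.c i, d.c, d.x' i, d.y' i, d.x i, d.y i, d.M.S.s i, d.M.S.c (i + 1), d.M'.S.s i, d.M'.S.c (i + 1)].getD k 0

/-- Leaf assignment of `MS2`. [folklore] -/
def act2 (i : ℕ) (k : ℕ) : ℕ :=
  [0, d.M.Dc d.L i, d.M'.Dc d.L i, d.CA.ge d.L i, d.c, d.M'.S.s i, d.nw i, d.a i, d.M.S.s i, (d.M.D d.L).ny i, d.M.Dc d.L (i + 1),
    (d.M'.D d.L).ny i, d.M'.Dc d.L (i + 1), d.CA.ny i, d.CA.ge d.L (i + 1), d.M.d d.L i, d.M'.d d.L i].getD k 0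

/-- The segments. [folklore] -/
def segs (K : PropForm ℕ) : List (List (PropForm ℕ)) :=
  [MS1.lines K d.act1 d.L,
   (List.range d.L).map (fun i => ctx K (biimp (var (d.M.S.s i)) (conj (var d.c) (var (d.M'.S.s i))))),
   MS2.lines K d.act2 d.L,
   (List.range d.L).map (fun i => ctx K (disj (neg (var d.c)) (biimp (var (d.M.d d.L i)) (var (d.M'.d d.L i))))),
   [ctx K (biimp (var (d.M.ge d.L)) (conj (var d.c) (var (d.M'.ge d.L))))],
   (List.range d.L).map (fun i => ctx K (biimp (var (d.M.R d.L i)) (conj (var d.c) (var (d.M'.R d.L i)))))]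

/-- The lines. [folklore] -/
def lines (K : PropForm ℕ) : List (PropForm ℕ) := (d.segs K).flatten

variable {G : FregeSystem} {K : PropForm ℕ} {T : Set (PropForm ℕ)}

/-- **Two related modular adders**: from `x = c ∧ x'`, `y = c ∧ y'` derive `R(M) = c ∧ R(M')`
bitwise. [cite: CookReckhow1979, §2] -/
theorem isBlock_lines (hG : ∀ r ∈ rules, r ∈ G.rules) (hM : d.M.Avail K T d.L) (hM' : d.M'.Avail K T d.L) (hCA : d.CA.Avail K T d.L)
    (hx : ∀ i < d.L, ctx K (biimp (var (d.x i)) (conj (var d.c) (var (d.x' i)))) ∈ T)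
    (hy : ∀ i < d.L, ctx K (biimp (var (d.y i)) (conj (var d.c) (var (d.y' i)))) ∈ T)
    (hlt : ctx K (neg (var (d.CA.ge d.L d.L))) ∈ T) : G.IsBlock T (d.lines K) := by
  refine ModAddU.AssocData.isBlock_flatten _ fun k hk => ?_
  simp only [segs, List.length_cons, List.length_nil] at hk
  have mem : ∀ {χ} (j : ℕ) (hj : j < k) (hχ : χ ∈ (d.segs K)[j]'(by simp [segs]; omega)),
      χ ∈ T ∪ {χ | ∃ j, ∃ hj : j < k, χ ∈ (d.segs K)[j]'(by simp [segs]; omega)} := fun j hj hχ => Or.inr ⟨j, hj, hχ⟩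
  have hΓ : T ⊆ T ∪ {χ | ∃ j, ∃ hj : j < k, χ ∈ (d.segs K)[j]'(by simp [segs]; omega)} := fun _ hχ => Or.inl hχ
  have mr : ∀ {f : ℕ → PropForm ℕ} {W i : ℕ}, i < W → f i ∈ (List.range W).map f := fun hi => List.mem_map.2 ⟨_, List.mem_range.2 hi, rfl⟩
  interval_cases k
  · -- 0: `MS1`
    refine System.isBlock_lines ms1LeavesOK (hG _ (List.getElem_mem (n := 0) (by decide))) (hG _ (List.getElem_mem (n := 1) (by decide)))
      K d.act1 d.L (ModAddU.hcoh_of (p := fun k => decide (1 ≤ k ∧ k ≤ 3)) (by decide +kernel) fun i _ k hk => by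
        simp only [decide_eq_true_eq] at hk
        obtain ⟨hk₁, hk₂⟩ := hk
        interval_cases k <;> rfl) (fun φ hφ => ?_) (fun i hi φ hφ => ?_)
    · simp only [MS1, List.mem_cons, List.not_mem_nil, or_false] at hφ
      rcases hφ with rfl | rfl
      exacts [hΓ hM.1.1, hΓ hM'.1.1]
    · simp only [MS1, List.mem_cons, List.not_mem_nil, or_false] at hφ
      rcases hφ with rfl | rfl | rfl | rfl | rfl | rfl
      exacts [hΓ (hx i hi), hΓ (hy i hi), hΓ (hM.1.2 i hi).1, hΓ (hM.1.2 i hi).2, hΓ (hM'.1.2 i hi).1, hΓ (hM'.1.2 i hi).2]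
  · -- 1: `s ↔ c ∧ s'`
    refine Scaffold.isBlock_of_forall fun θ hθ => ?_
    obtain ⟨i, hi, rfl⟩ := List.mem_map.1 hθ
    rw [List.mem_range] at hi
    refine Or.inr (System.isInferredFrom_end ms1LeavesOK.inv_ne_zero (hG _ (List.getElem_mem (n := 2) (by decide))) ms1LeavesOK.2.1
      (ModAddU.ne_zero_of_allVarsB (by decide +kernel)) K d.act1 i (mem 0 (by omega) (System.mem_lines MS1 K d.act1 hi.le)) fun φ hφ => ?_)
    simp only [MS1, List.mem_cons, List.not_mem_nil, or_false] at hφ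
    rcases hφ with rfl | rfl | rfl | rfl | rfl | rfl
    exacts [hΓ (hx i hi), hΓ (hy i hi), hΓ (hM.1.2 i hi).1, hΓ (hM.1.2 i hi).2, hΓ (hM'.1.2 i hi).1, hΓ (hM'.1.2 i hi).2]
  · -- 2: `MS2`
    refine System.isBlock_lines ms2LeavesOK (hG _ (List.getElem_mem (n := 3) (by decide))) (hG _ (List.getElem_mem (n := 4) (by decide)))
      K d.act2 d.L (ModAddU.hcoh_of (p := fun k => decide (1 ≤ k ∧ k ≤ 4)) (by decide +kernel) fun i _ k hk => by
        simp only [decide_eq_true_eq] at hk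
        obtain ⟨hk₁, hk₂⟩ := hk
        interval_cases k <;> rfl) (fun φ hφ => ?_) (fun i hi φ hφ => ?_)
    · simp only [MS2, List.mem_cons, List.not_mem_nil, or_false] at hφ
      rcases hφ with rfl | rfl | rfl
      exacts [hΓ hM.2.1.2.1, hΓ hM'.2.1.2.1, hΓ hCA.2.1]
    · simp only [MS2, List.mem_cons, List.not_mem_nil, or_false] at hφ
      rcases hφ with rfl | rfl | rfl | rfl | rfl | rfl | rfl | rfl | rfl
      exacts [mem 1 (by omega) (mr hi), hΓ (hM.2.1.1 i hi), hΓ (hM.2.1.2.2 i hi).2, hΓ (hM'.2.1.1 i hi), hΓ (hM'.2.1.2.2 i hi).2,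
        hΓ (hCA.1 i hi), hΓ (hCA.2.2 i hi).2, hΓ (hM.2.1.2.2 i hi).1, hΓ (hM'.2.1.2.2 i hi).1]
  · -- 3: `c → (d ↔ d')`
    refine Scaffold.isBlock_of_forall fun θ hθ => ?_
    obtain ⟨i, hi, rfl⟩ := List.mem_map.1 hθ
    rw [List.mem_range] at hi
    refine Or.inr (System.isInferredFrom_end ms2LeavesOK.inv_ne_zero (hG _ (List.getElem_mem (n := 5) (by decide))) ms2LeavesOK.2.1
      (ModAddU.ne_zero_of_allVarsB (by decide +kernel)) K d.act2 i (mem 2 (by omega) (System.mem_lines MS2 K d.act2 hi.le)) fun φ hφ => ?_)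
    simp only [MS2, List.mem_cons, List.not_mem_nil, or_false] at hφ
    rcases hφ with rfl | rfl | rfl | rfl | rfl | rfl | rfl | rfl | rfl
    exacts [mem 1 (by omega) (mr hi), hΓ (hM.2.1.1 i hi), hΓ (hM.2.1.2.2 i hi).2, hΓ (hM'.2.1.1 i hi), hΓ (hM'.2.1.2.2 i hi).2,
      hΓ (hCA.1 i hi), hΓ (hCA.2.2 i hi).2, hΓ (hM.2.1.2.2 i hi).1, hΓ (hM'.2.1.2.2 i hi).1]
  · -- 4: `ge ↔ c ∧ ge'`
    exact FregeSystem.IsBlock.singleton (Or.inr (System.isInferredFrom_end ms2LeavesOK.inv_ne_zero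
      (hG _ (List.getElem_mem (n := 6) (by decide))) (System.forall_ne_zero_of_shapesOKB (by decide +kernel))
      (ModAddU.ne_zero_of_allVarsB (by decide +kernel)) K d.act2 d.L (mem 2 (by omega) (System.mem_lines MS2 K d.act2 le_rfl))
      fun φ hφ => by rw [List.mem_singleton.1 hφ]; exact hΓ hlt))
  · -- 5: `R ↔ c ∧ R'`
    refine Scaffold.isBlock_of_forall fun θ hθ => ?_
    obtain ⟨i, hi, rfl⟩ := List.mem_map.1 hθ
    rw [List.mem_range] at hi
    refine Or.inr (infer hG 7 (by decide) (FregeSystem.sub [K, var (d.M.R d.L i), var (d.M.ge d.L), var (d.M.d d.L i), var (d.M.S.s i),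
      var (d.M'.R d.L i), var (d.M'.ge d.L), var (d.M'.d d.L i), var (d.M'.S.s i), var d.c]) rfl fun ψ hψ => ?_)
    simp only [rules, List.getElem_cons_succ, List.getElem_cons_zero, rMuxRel, List.mem_cons, List.not_mem_nil, or_false] at hψ
    rcases hψ with rfl | rfl | rfl | rfl | rfl
    · exact hΓ (hM.2.2 i hi)
    · exact hΓ (hM'.2.2 i hi)
    · exact mem 4 (by omega) (List.mem_singleton_self _)
    · exact mem 1 (by omega) (mr hi)
    · exact mem 3 (by omega) (mr hi)

/-- The conclusions: `R(M)ᵢ ↔ c ∧ R(M')ᵢ`. [folklore] -/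
theorem mem_lines {i : ℕ} (hi : i < d.L) : ctx K (biimp (var (d.M.R d.L i)) (conj (var d.c) (var (d.M'.R d.L i)))) ∈ d.lines K := by
  simp only [lines, segs, List.flatten_cons, List.flatten_nil, List.mem_append, List.append_nil]
  exact Or.inr (Or.inr (Or.inr (Or.inr (Or.inr (List.mem_map.2 ⟨i, List.mem_range.2 hi, rfl⟩)))))

/-- Size of the block: every line `≤ |K| + 60`, `5L + 3` lines. [folklore] -/
theorem proofSize_lines (K : PropForm ℕ) : proofSize (d.lines K) ≤ (5 * d.L + 3) * (K.size + 60) := by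
  have h1 : MS1.inv.size ≤ 50 := by decide +kernel
  have h2 : MS2.inv.size ≤ 50 := by decide +kernel
  refine (ModAddU.Bounded.proofSize_le (B := K.size + 60) (ModAddU.Bounded.flatten fun D hD => ?_)).trans ?_
  · simp only [segs, List.mem_cons, List.not_mem_nil, or_false] at hD
    rcases hD with rfl | rfl | rfl | rfl | rfl | rfl
    · exact ModAddU.bounded_sysLines (B := K.size + 60) _ _ _ _ (by omega)
    · exact ModAddU.Bounded.map fun i _ => by rw [ModAddU.size_ctx, FregeSystem.size_biimp]; simp [size]
    · exact ModAddU.bounded_sysLines (B := K.size + 60) _ _ _ _ (by omega)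
    · exact ModAddU.Bounded.map fun i _ => by rw [ModAddU.size_ctx]; simp [size, FregeSystem.size_biimp]
    · exact ModAddU.Bounded.singleton (by rw [ModAddU.size_ctx, FregeSystem.size_biimp]; simp [size])
    · exact ModAddU.Bounded.map fun i _ => by rw [ModAddU.size_ctx, FregeSystem.size_biimp]; simp [size]
  · apply Nat.mul_le_mul_right
    simp only [segs, List.flatten_cons, List.flatten_nil, List.length_append, List.length_map, List.length_range,
      System.lines, List.length_cons, List.length_nil, List.append_nil]
    omega

end RelData

/-! ### The mask law -/

/-- The data of the mask law: `V = a ⊗ w`, `V' = a ⊗ b` (same multiplicand, same modulus),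
the bit `c` with `wⱼ ↔ c ∧ bⱼ`. [folklore] -/
structure MulData where
  /-- width -/
  L : ℕ
  /-- base of `V` -/
  bV : ℕ
  /-- base of `V'` -/
  bV' : ℕ
  /-- the multiplicand -/
  a : ℕ → ℕ
  /-- the multiplier of `V` (the mask) -/
  w : ℕ → ℕ
  /-- the multiplier of `V'` -/
  b : ℕ → ℕ
  /-- the modulus -/
  nw : ℕ → ℕ
  /-- the bit -/
  c : ℕ

namespace MulData

variable (d : MulData)

/-- `V = a ⊗ w`. [folklore] -/
def V : View := ⟨d.bV, d.a, d.w, d.nw⟩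
/-- `V' = a ⊗ b`. [folklore] -/
def V' : View := ⟨d.bV', d.a, d.b, d.nw⟩

/-- The related doublings of stage `t`. [folklore] -/
def rd1 (t : ℕ) : RelData :=
  ⟨d.L, d.bV + offD d.L t, d.bV' + offD d.L t, d.V.P d.L t, d.V.P d.L t, d.V'.P d.L t, d.V'.P d.L t, d.nw, d.V.rbase d.L 1, d.a, d.c⟩
/-- The related accumulations of stage `t`. [folklore] -/
def rd2 (t : ℕ) : RelData :=
  ⟨d.L, d.bV + offA d.L t, d.bV' + offA d.L t, (d.V.Dv d.L t).R d.L, d.V.msk d.L t, (d.V'.Dv d.L t).R d.L, d.V'.msk d.L t, d.nw,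
    d.V.rbase d.L 1, d.a, d.c⟩

/-- The stage `t`. [folklore] -/
def stage (K : PropForm ℕ) (t : ℕ) : List (PropForm ℕ) :=
  (d.rd1 t).lines K ++ ((List.range d.L).map (fun i => ctx K (biimp (var (d.V.msk d.L t i)) (conj (var d.c) (var (d.V'.msk d.L t i))))) ++
    (d.rd2 t).lines K)

/-- The stages below `t`. [folklore] -/
def upTo (K : PropForm ℕ) : ℕ → List (PropForm ℕ)
  | 0 => [ctx K (neg (var d.V.z)), ctx K (neg (var d.V'.z))] ++ (List.range d.L).map fun i => ctx K (biimp (var (d.V.P d.L 0 i)) (conj (var d.c) (var (d.V'.P d.L 0 i))))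
  | t + 1 => upTo K t ++ d.stage K t

/-- **The lines of the mask law.** [folklore] -/
def lines (K : PropForm ℕ) : List (PropForm ℕ) := d.upTo K d.L

variable {G : FregeSystem} {K : PropForm ℕ} {Γ : Set (PropForm ℕ)}

/-- `P_t(V) ≡ c ∧ P_t(V')` is among the lines up to `t`. [folklore] -/
theorem mem_upTo : ∀ {t i : ℕ}, i < d.L → ctx K (biimp (var (d.V.P d.L t i)) (conj (var d.c) (var (d.V'.P d.L t i)))) ∈ d.upTo K t
  | 0, _, hi => List.mem_append_right _ (List.mem_map.2 ⟨_, List.mem_range.2 hi, rfl⟩)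
  | t + 1, i, hi => by
    rw [View.P_succ, View.P_succ]
    exact List.mem_append_right _ (List.mem_append_right _ (List.mem_append_right _ ((d.rd2 t).mem_lines (K := K) hi)))

/-- **The mask law of modular multiplication inside Frege**: `P_t(a ⊗ w) ≡ c ∧ P_t(a ⊗ b)`
bitwise, for `w = c ∧ b` bitwise. [cite: CookReckhow1979, §2] -/
theorem isBlock_upTo (hG : ∀ r ∈ rules, r ∈ G.rules) (hGL : ∀ r ∈ Logic.rules, r ∈ G.rules) (hV : d.V.Avail d.L K Γ)
    (hV' : d.V'.Avail d.L K Γ) (hCA : (d.V.CA d.L).Avail K Γ d.L) (hlt : ctx K (neg (var ((d.V.CA d.L).ge d.L d.L))) ∈ Γ)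
    (hw : ∀ j < d.L, ctx K (biimp (var (d.w j)) (conj (var d.c) (var (d.b j)))) ∈ Γ) : ∀ t ≤ d.L, G.IsBlock Γ (d.upTo K t) := by
  intro t ht
  induction t with
  | zero =>
    refine (FregeSystem.IsBlock.cons (Or.inr (Logic.infer hGL 11 (by decide) (FregeSystem.sub [K, var d.V.z]) rfl
      (FregeSystem.prems_cons hV.hz FregeSystem.prems_nil))) (FregeSystem.IsBlock.singleton (Or.inr (Logic.infer hGL 11 (by decide)
      (FregeSystem.sub [K, var d.V'.z]) rfl (FregeSystem.prems_cons (Or.inl hV'.hz) FregeSystem.prems_nil))))).append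
      (Scaffold.isBlock_of_forall fun θ hθ => ?_)
    obtain ⟨i, hi, rfl⟩ := List.mem_map.1 hθ
    refine Or.inr (infer hG 9 (by decide) (FregeSystem.sub [K, var (d.V.P d.L 0 i), var d.c, var (d.V'.P d.L 0 i)]) rfl fun ψ hψ => ?_)
    simp only [rules, List.getElem_cons_succ, List.getElem_cons_zero, rRelFF, List.mem_cons, List.not_mem_nil, or_false] at hψ
    rcases hψ with rfl | rfl
    · exact Or.inr List.mem_cons_self
    · exact Or.inr (List.mem_cons_of_mem _ List.mem_cons_self)
  | succ t ih =>
    have ht' : t < d.L := by omega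
    have s1 : ∀ {A B : Set (PropForm ℕ)}, A ⊆ A ∪ B := fun {_ _} => Set.subset_union_left
    rw [upTo]
    refine (ih (by omega)).append ?_
    refine ((d.rd1 t).isBlock_lines hG ((hV.hD t ht').mono s1) ((hV'.hD t ht').mono s1) (hCA.mono s1)
      (fun i hi => Or.inr (d.mem_upTo hi)) (fun i hi => Or.inr (d.mem_upTo hi)) (s1 hlt)).append ?_
    refine (Scaffold.isBlock_of_forall fun θ hθ => ?_).append ?_
    · obtain ⟨i, hi, rfl⟩ := List.mem_map.1 hθ
      rw [List.mem_range] at hi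
      refine Or.inr (infer hG 8 (by decide) (FregeSystem.sub [K, var (d.V.msk d.L t i), var (d.w (d.L - 1 - t)), var (d.a i),
        var (d.V'.msk d.L t i), var (d.b (d.L - 1 - t)), var d.c]) rfl fun ψ hψ => ?_)
      simp only [rules, List.getElem_cons_succ, List.getElem_cons_zero, rMaskRel, List.mem_cons, List.not_mem_nil, or_false] at hψ
      rcases hψ with rfl | rfl | rfl
      · exact s1 (s1 (hV.hmk t ht' i hi))
      · exact s1 (s1 (hV'.hmk t ht' i hi))
      · exact s1 (s1 (hw _ (by omega)))
    · exact (d.rd2 t).isBlock_lines hG ((((hV.hA t ht').mono s1).mono s1).mono s1) ((((hV'.hA t ht').mono s1).mono s1).mono s1)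
        (((hCA.mono s1).mono s1).mono s1) (fun i hi => Or.inl (Or.inr ((d.rd1 t).mem_lines hi)))
        (fun i hi => Or.inr (List.mem_map.2 ⟨i, List.mem_range.2 hi, rfl⟩)) (s1 (s1 (s1 hlt)))

/-- **The mask law**: the lines form a block. [cite: CookReckhow1979, §2] -/
theorem isBlock_lines (hG : ∀ r ∈ rules, r ∈ G.rules) (hGL : ∀ r ∈ Logic.rules, r ∈ G.rules) (hV : d.V.Avail d.L K Γ)
    (hV' : d.V'.Avail d.L K Γ) (hCA : (d.V.CA d.L).Avail K Γ d.L) (hlt : ctx K (neg (var ((d.V.CA d.L).ge d.L d.L))) ∈ Γ)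
    (hw : ∀ j < d.L, ctx K (biimp (var (d.w j)) (conj (var d.c) (var (d.b j)))) ∈ Γ) : G.IsBlock Γ (d.lines K) :=
  d.isBlock_upTo hG hGL hV hV' hCA hlt hw d.L le_rfl

/-- **The conclusion of the mask law**: `P_L(a ⊗ w)ᵢ ↔ c ∧ P_L(a ⊗ b)ᵢ`. [folklore] -/
theorem mem_lines {i : ℕ} (hi : i < d.L) : ctx K (biimp (var (d.V.P d.L d.L i)) (conj (var d.c) (var (d.V'.P d.L d.L i)))) ∈ d.lines K :=
  d.mem_upTo hi

/-- **Size of the mask law**: `≤ (L + 2 + L(11L + 6))(|K| + 60)`. [folklore] -/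
theorem proofSize_lines (K : PropForm ℕ) : proofSize (d.lines K) ≤ (d.L + 2 + d.L * (11 * d.L + 6)) * (K.size + 60) := by
  suffices h : ∀ t, proofSize (d.upTo K t) ≤ (d.L + 2 + t * (11 * d.L + 6)) * (K.size + 60) from h d.L
  intro t
  induction t with
  | zero =>
    rw [upTo, Nat.zero_mul, Nat.add_zero]
    refine (ModAddU.Bounded.proofSize_le (B := K.size + 60) fun θ hθ => ?_).trans (by simp)
    simp only [List.mem_append, List.mem_cons, List.not_mem_nil, or_false, List.mem_map] at hθ
    rcases hθ with (rfl | rfl) | ⟨i, -, rfl⟩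
    · rw [ModAddU.size_ctx]; simp [size]
    · rw [ModAddU.size_ctx]; simp [size]
    · rw [ModAddU.size_ctx, FregeSystem.size_biimp]; simp [size]
  | succ t ih =>
    rw [upTo, proofSize_append]
    have h1 := (d.rd1 t).proofSize_lines K
    have h2 := (d.rd2 t).proofSize_lines K
    have h3 : proofSize ((List.range d.L).map (fun i => ctx K (biimp (var (d.V.msk d.L t i)) (conj (var d.c) (var (d.V'.msk d.L t i)))))) ≤
        d.L * (K.size + 60) := by
      refine (ModAddU.Bounded.proofSize_le (B := K.size + 60) (ModAddU.Bounded.map fun i _ => ?_)).trans (by simp)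
      rw [ModAddU.size_ctx, FregeSystem.size_biimp]; simp [size]
    have e1 : (d.rd1 t).L = d.L := rfl
    have e2 : (d.rd2 t).L = d.L := rfl
    rw [e1] at h1; rw [e2] at h2
    rw [stage, proofSize_append, proofSize_append]
    nlinarith

end MulData

end MaskMul

end ModMulU

end Literature.Computability.MetaComplexity
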